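import Summits.BirchSwinnertonDyer.BirchSwinnertonDyer.Theorems.PrintCFramBottomClassIndexLawFiveLeBorelKummerDescentPow
import Summits.BirchSwinnertonDyer.BirchSwinnertonDyer.Theorems.PrintCFramBottomClassIndexLawFiveLeBorelGrossSurjectivityTowerLeaf
import HarnessLib

/-!
# Route `PrintCFram`, crux C2 `BottomClassIndexLawFiveLe` (stmt-BirchSwinnertonDyer-20372), line
# `eisenstein-resource-bdp-line` (S2 `stub_kolyvaginUpper_borelCM_pairSum_offKrizLi`, the `𝓞`-action
# on cohomology): **`[μ_* x, ρ] = μ [x, ρ]`** — the coefficient endomorphism `√−p` acts on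
# `H¹(F, W[p^M])` compatibly with the Kolyvagin evaluations, so McCallum's (2) holds at the Borel
# prime in CLASS form: `𝓞`-independent classes have jointly surjective evaluations
# (cell `bsd-print-cfram`, seat `bsd-line-cfram-p1-w2` g5; helper `--supports` 20372; 0 facts, 0 defs)

HONEST FRAMING. Nothing about BSD is proved here, and nothing of S2 itself. The `𝔭`-adic McCallum (2)
of file 8e (`exists_h1Eval_eq_pow_of_cmRamified`) was stated with hypotheses on EVALUATIONS
(`μ^{eᵢ}` kills all `[xᵢ, ρ]`; the top-layer functionals `∑ cᵢ μ^{eᵢ−1}[xᵢ, ·]` are independent).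
Over `F ∋ √−p` the endomorphism `μ = √−p` is `Γ_F`-equivariant on `W(F̄)[n]`, so it acts on
`H¹(F, W[n])` by Mathlib's functoriality `ContinuousCohomology.map (id) (resHomOfEquivariant id ψ _) 1`
(the tree's construction behind `conjAct`), and this file proves the compatibility
**`[μ_* x, ρ] = μ [x, ρ]`** (`h1Eval_coeffMap`, any field, any equivariant `ψ` on `E[n]`; verbatim
the computation of the tree's `IsLiftOfAut.h1Eval_conjAct` with the identity on the group). With
(α) over `F` (file 9) the evaluation-form hypotheses follow from CLASS-form ones, giving the
consumer-facing END STATE `exists_h1Eval_eq_pow_of_classIndep_of_sqrt_mem`: for classes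
`xᵢ ∈ H¹(F, W[p^M])` with `μ_*^{eᵢ} xᵢ = 0` and `∑ cᵢ μ_*^{eᵢ−1} xᵢ = 0 ⟹ p ∣ cᵢ` (`𝓞`-independence of
`C = ⊕ 𝓞/𝔭^{eᵢ} xᵢ`), every `t ∈ ∏ W(F̄)[𝔭^{eᵢ}]` is a joint evaluation `([xᵢ, ρ])ᵢ`. To stay
definition-free the `H¹`-operator is any additive `Mψ` satisfying `[Mψ x, ρ] = ψ[x, ρ]` (hypothesis
`hM`, discharged by `h1Eval_coeffMap` for the canonical one) and `ψ` any additive map on `W(F̄)[p^M]`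
agreeing with `μ` through `θ` (hypothesis `hψ`). THEOREMS ONLY; no definition, no named fact, no
`sorry`. BSD is not proved by any of this; no summit statement is proved by this seat.
References: [SerreGaloisCohomology1997] I §2.4, §5.1 (functoriality on cocycles); [McCallumLMS1991]
§3 (2); [GrossLMS1991] §9.
-/

set_option autoImplicit false
-- `…BirchSwinnertonDyer.BirchSwinnertonDyer.Theorems…` is the problem's mandated namespace (D-0017).
set_option linter.dupNamespace false

noncomputable section

open scoped Classical

namespace Summit.BirchSwinnertonDyer.BirchSwinnertonDyer.Theorems.PrintCFram.BorelKolyvaginPairing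

open WeierstrassCurve Field Literature.NumberTheory.EllipticCurves
  Literature.NumberTheory.EllipticCurves.KolyvaginPairing Literature.NumberTheory.GaloisRepresentations
  Literature.NumberTheory.EllipticCurves.Rank1Residual
  Summit.BirchSwinnertonDyer.BirchSwinnertonDyer.Theorems.PrintCFram.BorelHomothety

universe u

/-! ## §1 `[ψ_* x, ρ] = ψ [x, ρ]` for an equivariant endomorphism `ψ` of `E[n]` (any field) -/

section CoeffMap

variable {K : Type u} [Field K] (V : WeierstrassCurve K) (n : ℤ)

/-- **`[ψ_* x, ρ] = ψ [x, ρ]`.** For a `Γ_K`-equivariant additive `ψ : E[n] → E[n]` and the induced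
map `ψ_* = H¹(id, ψ)` on `H¹(K, E[n])` (Mathlib `ContinuousCohomology.map` along the compatible pair
`(id, ψ)`, the tree's `resHomOfEquivariant`): the evaluation at `ρ ∈ Γ_{K(E[n])}` of `ψ_* x` is `ψ`
of the evaluation of `x` — on cocycles `ψ_*[f] = [ψ ∘ f]`. [cite: SerreGaloisCohomology1997, I §5.1]
[cite: GrossLMS1991, §9 (pairing after Prop. 9.1)] -/
theorem h1Eval_coeffMap (ψ : geomTorsion V n →+ geomTorsion V n)
    (hψ : ∀ (g : absoluteGaloisGroup K) (t : geomTorsion V n), ψ (g • t) = g • ψ t)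
    (x : galH1Torsion V n) {ρ : absoluteGaloisGroup K} (hρ : ρ ∈ torsionFixing V n) :
    h1Eval V n ((ContinuousCohomology.map (ContinuousMonoidHom.id (absoluteGaloisGroup K))
        (resHomOfEquivariant (ContinuousMonoidHom.id (absoluteGaloisGroup K)) ψ (fun g t => hψ g t))
        1).hom.toLinearMap.toAddMonoidHom x) ρ = ψ (h1Eval V n x ρ) := by
  conv_lhs => rw [← oneCocycleClass_reprCocycle V n x]
  rw [LinearMap.toAddMonoidHom_coe, ContinuousLinearMap.coe_coe, map_oneCocycleClass,
    h1Eval_oneCocycleClass _ n _ hρ, contOneCocycles.pullback_apply]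
  rfl

/-- **Iterates: `[ψ_*^k x, ρ] = ψ^k [x, ρ]`** for any additive `Mψ` on `H¹(K, E[n])` with
`[Mψ x, ρ] = ψ [x, ρ]` (e.g. `ψ_*`, by `h1Eval_coeffMap`). [folklore] -/
theorem h1Eval_iterate_of_compat (ψ : geomTorsion V n →+ geomTorsion V n)
    (Mψ : galH1Torsion V n →+ galH1Torsion V n)
    (hM : ∀ (x : galH1Torsion V n) {ρ : absoluteGaloisGroup K}, ρ ∈ torsionFixing V n →
      h1Eval V n (Mψ x) ρ = ψ (h1Eval V n x ρ))
    (k : ℕ) (x : galH1Torsion V n) {ρ : absoluteGaloisGroup K} (hρ : ρ ∈ torsionFixing V n) :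
    h1Eval V n (Mψ^[k] x) ρ = ψ^[k] (h1Eval V n x ρ) := by
  induction k generalizing x with
  | zero => rfl
  | succ k ih => rw [Function.iterate_succ_apply, Function.iterate_succ_apply, ih (Mψ x), hM x hρ]

end CoeffMap

/-! ## §2 The Borel CM leaf over `F ∋ √−p`: McCallum's (2) in CLASS form -/

section LeafClass

variable (W : WeierstrassCurve ℚ) [W.IsElliptic] (p : ℕ) [hp : Fact p.Prime]
variable (F : Type) [Field F] [NumberField F]

omit [W.IsElliptic] hp in
/-- Iterates of an additive `ψ` on `W(F̄)[n]` agreeing with `μ` through `θ` agree with `μ^k`.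
[folklore] -/
theorem coe_symm_iterate_eq_pow_apply {n : ℤ} {μ : AddMonoid.End W.geomPoints}
    (ψ : geomTorsion (W.baseChange F) n →+ geomTorsion (W.baseChange F) n)
    (hψ : ∀ t, (((RatClosure.torsionEquiv (K := F) W n).symm (ψ t) : W.geomTorsion n) : W.geomPoints) =
      μ ((RatClosure.torsionEquiv (K := F) W n).symm t : W.geomTorsion n))
    (k : ℕ) (t : geomTorsion (W.baseChange F) n) :
    (((RatClosure.torsionEquiv (K := F) W n).symm (ψ^[k] t) : W.geomTorsion n) : W.geomPoints) =
      (μ ^ k) ((RatClosure.torsionEquiv (K := F) W n).symm t : W.geomTorsion n) := by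
  induction k generalizing t with
  | zero => rfl
  | succ k ih => rw [Function.iterate_succ_apply', pow_succ_apply, hψ, ih]

/-- **McCallum (2) at the Borel CM prime, CLASS form.** `W/ℚ` CM, `p ≥ 5` CM-ramified, `μ = √−p`
with its sign rule; `F` a number field with `√−p ∈ F`, `(p−1) ∤ [F:ℚ]` and `[F:ℚ] < p` (the compositum
`K·K''`); `M ≥ 1`; `ψ` an additive map on `W(F̄)[p^M]` agreeing with `μ` through
`θ = RatClosure.torsionEquiv`, and `Mψ` an additive map on `H¹(F, W[p^M])` with `[Mψ x, ρ] = ψ[x, ρ]`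
(the canonical `μ_*`: `h1Eval_coeffMap`). If the classes `xᵢ` (`i ∈ ι` finite) satisfy
`Mψ^{eᵢ} xᵢ = 0` and are `𝓞`-INDEPENDENT — `∑ cᵢ Mψ^{eᵢ−1} xᵢ = 0 ⟹ p ∣ cᵢ` for `eᵢ > 0` — then every
`t` with `μ^{eᵢ}(θ⁻¹ tᵢ) = 0` is `([xᵢ, ρ])ᵢ` for some `ρ ∈ Γ_{F(W[p^M])}`. (Evaluation-form
hypotheses of file 8e from the class form through `[Mψ^k x, ρ] = ψ^k[x, ρ]` and the injectivity (α)
over `F`, file 9.) [cite: McCallumLMS1991, §3 (2)] [cite: GrossLMS1991, Prop. 9.1, 9.3] -/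
theorem exists_h1Eval_eq_pow_of_classIndep_of_sqrt_mem (hCM : W.HasCM) (h5 : 5 ≤ p)
    (hram : CMRamified W p) {s : AlgebraicClosure ℚ} {μ : AddMonoid.End W.geomPoints} {m : ℤ}
    (hs : s ^ 2 = ((-(p : ℤ) : ℤ) : AlgebraicClosure ℚ)) (hm : m.natAbs = p)
    (hμμ : ∀ P, μ (μ P) = m • P)
    (hcomm : ∀ g : absoluteGaloisGroup ℚ, g • s = s → ∀ P, μ (g • P) = g • μ P)
    (hF : ∃ y : F, y ^ 2 = -(p : F)) (hdeg : ¬ (p - 1) ∣ Module.finrank ℚ F)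
    (hK : Module.finrank ℚ F < p) {M : ℕ} (hM : 1 ≤ M)
    (ψ : geomTorsion (W.baseChange F) ((p ^ M : ℕ) : ℤ) →+ geomTorsion (W.baseChange F) ((p ^ M : ℕ) : ℤ))
    (hψ : ∀ t, (((RatClosure.torsionEquiv (K := F) W ((p ^ M : ℕ) : ℤ)).symm (ψ t) :
        W.geomTorsion ((p ^ M : ℕ) : ℤ)) : W.geomPoints) =
      μ ((RatClosure.torsionEquiv (K := F) W ((p ^ M : ℕ) : ℤ)).symm t : W.geomTorsion ((p ^ M : ℕ) : ℤ)))
    (Mψ : galH1Torsion (W.baseChange F) ((p ^ M : ℕ) : ℤ) →+ galH1Torsion (W.baseChange F) ((p ^ M : ℕ) : ℤ))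
    (hMψ : ∀ (x : galH1Torsion (W.baseChange F) ((p ^ M : ℕ) : ℤ)) {ρ : absoluteGaloisGroup F},
      ρ ∈ torsionFixing (W.baseChange F) ((p ^ M : ℕ) : ℤ) →
        h1Eval (W.baseChange F) ((p ^ M : ℕ) : ℤ) (Mψ x) ρ = ψ (h1Eval (W.baseChange F) ((p ^ M : ℕ) : ℤ) x ρ))
    {ι : Type*} [Fintype ι] (xs : ι → galH1Torsion (W.baseChange F) ((p ^ M : ℕ) : ℤ)) (e : ι → ℕ)
    (he : ∀ i, Mψ^[e i] (xs i) = 0)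
    (hind : ∀ c : ι → ℤ, ∑ i, c i • Mψ^[e i - 1] (xs i) = 0 → ∀ i, 0 < e i → (p : ℤ) ∣ c i)
    (t : ι → geomTorsion (W.baseChange F) ((p ^ M : ℕ) : ℤ))
    (ht : ∀ i, (μ ^ e i)
      ((RatClosure.torsionEquiv (K := F) W ((p ^ M : ℕ) : ℤ)).symm (t i) : W.geomPoints) = 0) :
    ∃ ρ ∈ torsionFixing (W.baseChange F) ((p ^ M : ℕ) : ℤ),
      ∀ i, h1Eval (W.baseChange F) ((p ^ M : ℕ) : ℤ) (xs i) ρ = t i := by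
  set θ := RatClosure.torsionEquiv (K := F) W ((p ^ M : ℕ) : ℤ) with hθ
  -- `μ^k (θ⁻¹ [x, ρ]) = θ⁻¹ [Mψ^k x, ρ]`
  have hkey : ∀ (k : ℕ) (x : galH1Torsion (W.baseChange F) ((p ^ M : ℕ) : ℤ))
      {ρ : absoluteGaloisGroup F}, ρ ∈ torsionFixing (W.baseChange F) ((p ^ M : ℕ) : ℤ) →
      (μ ^ k) ((θ.symm (h1Eval (W.baseChange F) _ x ρ) : W.geomTorsion ((p ^ M : ℕ) : ℤ)) : W.geomPoints) =
        ((θ.symm (h1Eval (W.baseChange F) _ (Mψ^[k] x) ρ) : W.geomTorsion ((p ^ M : ℕ) : ℤ)) : W.geomPoints) := by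
    intro k x ρ hρ
    rw [h1Eval_iterate_of_compat (W.baseChange F) _ ψ Mψ hMψ k x hρ,
      coe_symm_iterate_eq_pow_apply W F ψ hψ k]
  refine exists_h1Eval_eq_pow_of_cmRamified W p F hCM h5 hram hs hm hμμ hcomm hK hM xs e
    (fun i ρ hρ => ?_) (fun c hc i hi => hind c ?_ i hi) t ht
  · -- evaluations killed by `μ^{eᵢ}`
    rw [hkey (e i) (xs i) hρ, he i, h1Eval_zero _ _ hρ, map_zero, ZeroMemClass.coe_zero]
  · -- class-form relation from the evaluation-form one, by (α) over `F`
    refine eq_zero_of_forall_h1Eval_eq_zero_of_sqrt_mem W p F hCM h5 hram hF hdeg hM fun ρ hρ => ?_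
    have hsum : ((θ.symm (h1Eval (W.baseChange F) _ (∑ i, c i • Mψ^[e i - 1] (xs i)) ρ) :
        W.geomTorsion ((p ^ M : ℕ) : ℤ)) : W.geomPoints) = 0 := by
      rw [h1Eval_sum _ _ _ _ hρ, map_sum, AddSubgroup.val_finsetSum, ← hc ρ hρ]
      refine Finset.sum_congr rfl fun i _ => ?_
      rw [h1Eval_zsmul _ _ _ _ hρ, map_zsmul, AddSubgroupClass.coe_zsmul, hkey (e i - 1) (xs i) hρ]
    have h0 : θ.symm (h1Eval (W.baseChange F) _ (∑ i, c i • Mψ^[e i - 1] (xs i)) ρ) = 0 :=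
      Subtype.ext (hsum.trans (ZeroMemClass.coe_zero _).symm)
    exact θ.symm.map_eq_zero_iff.mp h0

end LeafClass

end Summit.BirchSwinnertonDyer.BirchSwinnertonDyer.Theorems.PrintCFram.BorelKolyvaginPairing

end
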